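import Literature.MathematicalPhysics.QuantumFieldTheory.Balaban1983to89.B9Cor35CDirWordAtField
import Literature.MathematicalPhysics.QuantumFieldTheory.Balaban1983to89.B9Cor35CDirEngineAtCarrier
import Literature.MathematicalPhysics.QuantumFieldTheory.Balaban1983to89.B9Cor36GpDirExtAtField

/-!
# `Balaban1983to89.B9Cor35CDirAtCubeField` — [Balaban1985BackgroundPropagators] COROLLARY 3.5 ∕ 3.6 pp. 407–408 FOR PRINT's DIRICHLET THIRD CUBE LETTER
# `C_□(Ṽ) = (Q′_□(Ṽ)G′_□(Ṽ)²Q′*_□(Ṽ))⁻¹` (p. 409 l. 1–5, Dirichlet on `Ω₀(□)`) AT THE SMALL FIELD `Ṽ = e^{iηÃ}·1` OF A CUT POTENTIAL: it EXISTS on the blocks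
# inside `Ω₀(□)` and node00-def-Y's letter `XinvCubeDY … Ṽ` read on the carrier (`CinvR b i □ Ṽ`) obeys THEOREM 3.2 (3.48) — the Dirichlet twin of r05's
# `B9Cor35CinvAtCubeLetters.cor35_Cinv_cube`, assembled from the engine run (`cor35_CDir_carrier`), n06-a's `GextDirK_eq_GpDirVK`, and U6b-iv
# (`word_at`, `eq_CinvR_of_laws`) (ROAD (I) U6b-v; seat dag-n06-c g33)

statement-level skeleton of published theorems with citation tags; proofs where landed; nothing here is a claim about the Yang–Mills mass gap

## What this file does (mathematically)

[Balaban1985BackgroundPropagators] Cor. 3.5 p. 407 and Cor. 3.6 p. 408 put Theorem 3.4 (p. 400; its `C`-step p. 403) at the cube sequence's Dirichlet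
letters for `U = 1` and a small field `U′ = e^{iηA}` on `Ω₀(□)` (p. 408 «Ω₀(□) ⊂ □⁵», gauge `u`).  ★★★ `cor35_CDir_cube`: constants `δ, B > 0`, thresholds
`M₀, T₀, N₀`, `a₁ > 0` (functions of `d, L, M₂, C_q`) such that for every member above threshold, every cover cube, every `0 ≤ α₁ ≤ a₁` and every vector
potential `A` whose cut `Ã = cutFldS Ω₀(□) A` obeys the five blockwise (3.37) bounds over the cube blocks, whose (3.59) kernels at `Ṽ = cutCfgS Ω₀(□) η A`
have size `C_q·α₁`, whose knit cube legs at `Ṽ` are contractive and whose knit-cube averaging letters obey the pointwise (3.59) sizes `C_q·α₁`: the padded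
compression of def-Y's block word `X_□(Ṽ) = Q′_□(Ṽ)G′_□(Ṽ)²Q′*_□(Ṽ)` (`G′_□ = GpDirY … Ω₀(□)`) to the blocks inside `Ω₀(□)` IS A UNIT, and
`CinvR b i □ Ṽ = conj b (η⁻⁴·𝔖|C_□(Ṽ)|𝔖)` has the Theorem-3.2 block majorant `B·ℓ(a)^{−4}·e^{−δd(a,a′)}` over `(toB6 (geoCK i □) Rr H, val ∘ fst)`.

## Status

Printed-statement pass + proof body (proof-backed; a port in the tree's vocabulary; assembly): [Balaban1985BackgroundPropagators] pp. 398–403, 407–409,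
re-read 2026-08-31.  Honest label: Theorem 3.2 for the Dirichlet third cube letter at the small field of a cut potential, with the `A`-dependent (3.37)∕(3.59)
data as hypotheses (their discharge from a (3.35) datum is n06-a's `gpDir_cube_at_field` pattern, not repeated here); the `P₁`-word (3.76)–(3.77) twin of r05's
`cor35_POne_cube` is the next file.  Node N06 of the `pub-ymgap` DAG is NOT discharged here and the Yang–Mills mass gap is NOT proved here.  NEW file; nothing
landed is modified.  No `sorry`, no `axiom`, no `instance`, no `notation`.  Net new unproved facts: 0.  Cell `pub-ymgap` (HUMAN RULING D-0062), node N06 [B9],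
seat `pub-ymgap-dag-n06-c` (g33), 2026-08-31.
RELATED, NOT DUPLICATED (searched 2026-08-31: `rg 'cor35_CDir_cube'` over `Literature ∕ Summits` = ∅): r05 `B9Cor35CinvAtCubeLetters.cor35_Cinv_cube` (whole torus),
n06-a `B9Cor36GpDirExtAtField` (the `G′_□` side; USED BY NAME), FILES `B9Cor35CDirEngineAtCarrier ∕ …PaddedCarrier ∕ …WordAtField` (USED BY NAME).
-/

noncomputable section

namespace Literature.MathematicalPhysics.QuantumFieldTheory.Balaban1983to89.B9Cor35CDirAtCubeField

open B6KLevelCensusIndexV1 (KIdx kGeo)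
open B6Cover236MultiLevelBlocks (cubes)
open B6RandomWalk (HasMajorant)
open B9Thm34Ext (toB6)
open B9Eq352DivFormLetters (conj)
open B9Eq39Adjoint (covD covDstar)
open B9Eq352DivForm (tauB)
open B9Eq360DeltaPrimeAY (AfldY chartA)
open B9Eq360DeltaPrimeACubeY (blkCubeY kFCubeY sFCubeY)
open B9CubeLettersOpsL0 (oddMh cubeFamY)
open B9CubeLettersBondOpsL0 (BlkCubeY qpKc qpsKc QpCubeY QpsCubeY)
open B9CubeGeometryInputs (geoCK RM1)
open B9Cor35GpCubeInputsAtOne (wK)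
open B9Cor35GpDirInputsAtOne (dirDomY)
open B9Cor35GpDirAtCubeLetters (cor35_GpDir_cube)
open B9Cor36GpDirExtAtField (GextDirK_eq_GpDirVK)
open B9Eq337CutFieldDirY (cutFldS cutCfgS)
open B9Eq360PadDeltaCubeYAgree (compr_sub_compr_eq_cutCfgS)
open B9CubeSequence408Mirrors (mem_dirDomC_of_lev_pos)
open B9Cor35CDirCarrierAtOne (SBlk CinvR)
open B9Cor35CDirEngineAtCarrier (cor35_CDir_carrier)
open B9Cor35CDirPaddedCarrier (eq_CinvR_of_laws)
open B9Cor35CDirWordAtField (word_at)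
open Node00 (SiteY CfgY toKT shiftY)
open Node00.OpsYLocalInverse (dirPadY)
open Node00.OpsYCubeDirInverse (GpDirY padDeltaCubeY)
open Node00.OpsYCubeDirInverseBond (indProjY)
open Node00.OpsYCubeKnitPar (parKnitCubeY parKnitCubeY_one)
open Node00.OpsYCubeProjectionG (XCubeGY)

variable {d ℓ : ℕ} {hd : 1 ≤ d + 1} {hL : Odd (ℓ + 1) ∧ 1 < ℓ + 1} {b₀ b₁ : ℝ}
variable {𝔸 : Type} [NormedRing 𝔸] [NormedAlgebra ℂ 𝔸] [CompleteSpace 𝔸]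
variable {ι : Type} [Fintype ι] (b : Module.Basis ι ℝ 𝔸)

/-- ★★★ **COROLLARY 3.5 ∕ 3.6 FOR PRINT's DIRICHLET THIRD CUBE LETTER AT THE SMALL FIELD OF A CUT POTENTIAL — THEOREM 3.2 FOR def-Y's `C_□(Ṽ)` ON THE BLOCKS
INSIDE `Ω₀(□)`, UNIFORMLY IN THE MEMBER AND THE COVER CUBE** (see the module doc for the dictionary).
[cite: Balaban1985BackgroundPropagators, Cor. 3.5 p.407, Cor. 3.6 p.408, Thm 3.4 p.400, p.403 l.8–12, Thm 3.2 (3.48) p.398, (3.57)–(3.60) pp.401–402, p.409 l.1–5; Balaban1984PropagatorsII, Prop. 2.3 (2.86)–(2.87) p.238, Lemma 2.1 p.234] -/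
theorem cor35_CDir_cube [DecidableEq ι] (d ℓ : ℕ) (hℓ : 1 ≤ ℓ) (Cq M₂ : ℝ) (hCq : 0 ≤ Cq) (hM₂ : 0 ≤ M₂) (hrepr : ∀ (v : 𝔸) (j : ι), |b.repr v j| ≤ M₂ * ‖v‖)
    (h1 : ‖(1 : 𝔸)‖ ≤ 1) :
    ∃ δ B M₀ T₀ : ℝ, ∃ N₀ : ℕ, 0 < δ ∧ 0 < B ∧ ∃ a₁ : ℝ, 0 < a₁ ∧
    ∀ {hd : 1 ≤ d + 1} {hL : Odd (ℓ + 1) ∧ 1 < ℓ + 1} {b₀ b₁ : ℝ} (i : KIdx d ℓ hd hL b₀ b₁) (c : ↥(cubes (toKT i).D.toDomains)) (Rr : ℝ) (H : Prop),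
      M₀ ≤ ((ℓ : ℝ) + 1) * (toKT i).Mh → N₀ + 1 ≤ (toKT i).R * ((ℓ + 1) * (toKT i).Mh) → T₀ ≤ RM1 i →
    ∀ (α₁ : ℝ), 0 ≤ α₁ → α₁ ≤ a₁ →
    ∀ (A : AfldY 𝔸 i),
      (∀ y x, blkCubeY i c x = y →
        ‖kFCubeY i c (parKnitCubeY i c) (fun _ _ => 1) (cutCfgS i (dirDomY i c) (kGeo i).eta A) y x‖ ≤ Cq * α₁ * wK i c y) →
      (∀ x, ‖sFCubeY i c (parKnitCubeY i c) (fun _ _ => 1) (cutCfgS i (dirDomY i c) (kGeo i).eta A) x‖ ≤ Cq * α₁) →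
      (∀ ν k x, ‖(((geoCK i c).eta : ℂ)⁻¹) • covDstar (shiftY i) (fun _ _ => (1 : 𝔸ˣ)) ν (chartA i (cutFldS i (dirDomY i c) A) k) x‖ ≤
        α₁ * ((geoCK i c).len (blkCubeY i c x) ^ 2)⁻¹) →
      (∀ μ ν x, ‖(((geoCK i c).eta : ℂ)⁻¹) • covD (shiftY i) (fun _ _ => (1 : 𝔸ˣ)) μ (chartA i (cutFldS i (dirDomY i c) A) ν) x‖ ≤
        α₁ * ((geoCK i c).len (blkCubeY i c x) ^ 2)⁻¹) →
      (∀ μ x, ‖(((geoCK i c).eta : ℂ)⁻¹) • covDstar (shiftY i) (fun _ _ => (1 : 𝔸ˣ)) μ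
          (tauB (shiftY i) (fun _ _ => (1 : 𝔸ˣ)) μ (chartA i (cutFldS i (dirDomY i c) A) μ)) x‖ ≤ α₁ * ((geoCK i c).len (blkCubeY i c x) ^ 2)⁻¹) →
      (∀ k x, ‖chartA i (cutFldS i (dirDomY i c) A) k x‖ ≤ α₁ * ((geoCK i c).len (blkCubeY i c x))⁻¹) →
      (∀ ν k x, ‖tauB (shiftY i) (fun _ _ => (1 : 𝔸ˣ)) ν (chartA i (cutFldS i (dirDomY i c) A) k) x‖ ≤ α₁ * ((geoCK i c).len (blkCubeY i c x))⁻¹) →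
      (∀ z w : SiteY i, ‖(parKnitCubeY i c (cutCfgS i (dirDomY i c) (kGeo i).eta A) z w : 𝔸)‖ ≤ 1 ∧
        ‖(((parKnitCubeY i c (cutCfgS i (dirDomY i c) (kGeo i).eta A) z w)⁻¹ : 𝔸ˣ) : 𝔸)‖ ≤ 1) →
      (∀ (s : BlkCubeY i c) (lam : SiteY i → 𝔸),
        ‖(QpCubeY i c (parKnitCubeY i c) (cutCfgS i (dirDomY i c) (kGeo i).eta A) lam - QpCubeY i c (parKnitCubeY i c) (fun _ _ => 1) lam) s‖ ≤
          Cq * α₁ * ∑ z, |qpKc i c s z| * ‖lam z‖) →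
      (∀ (z : SiteY i) (nu : BlkCubeY i c → 𝔸),
        ‖(QpsCubeY i c (parKnitCubeY i c) (cutCfgS i (dirDomY i c) (kGeo i).eta A) nu - QpsCubeY i c (parKnitCubeY i c) (fun _ _ => 1) nu) z‖ ≤
          Cq * α₁ * ∑ s, |qpsKc i c z s| * ‖nu s‖) →
      IsUnit (dirPadY (indProjY (SBlk i c))
        (XCubeGY i c (parKnitCubeY i c) (GpDirY i c (parKnitCubeY i c) (dirDomY i c)) (cutCfgS i (dirDomY i c) (kGeo i).eta A))) ∧
      HasMajorant (g := toB6 (geoCK i c) Rr H) (fun q : ↥(SBlk i c) × ι => (q.1 : BlkCubeY i c)) (CinvR b i c (cutCfgS i (dirDomY i c) (kGeo i).eta A))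
        (fun a a' => B * (geoCK i c).len a ^ (-(4 : ℝ)) * Real.exp (-(δ * (geoCK i c).dist a a'))) := by
  classical
  obtain ⟨δ, B, M₀, T₀, N₀, hδ, hB, a₁, ha₁, hC⟩ := cor35_CDir_carrier b d ℓ hℓ Cq M₂ hCq hM₂ hrepr h1
  obtain ⟨δG, BG, MG, TG, NG, -, -, aG, haG, BB, -, hG⟩ := cor35_GpDir_cube b d ℓ hℓ Cq M₂ hCq hM₂ hrepr h1
  refine ⟨δ, B, max M₀ MG, max T₀ TG, max N₀ NG, hδ, hB, min a₁ aG, lt_min ha₁ haG, ?_⟩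
  intro hd hL b₀ b₁ i c Rr H hM hN hT α₁ hα0 hα1 A hkF hsF h337B h337F h337Bτ hA hAτB hparV hF hFs
  have hM0 : M₀ ≤ ((ℓ : ℝ) + 1) * (toKT i).Mh := (le_max_left _ _).trans hM
  have hMG : MG ≤ ((ℓ : ℝ) + 1) * (toKT i).Mh := (le_max_right _ _).trans hM
  have hN0 : N₀ + 1 ≤ (toKT i).R * ((ℓ + 1) * (toKT i).Mh) := le_trans (Nat.succ_le_succ (le_max_left _ _)) hN
  have hNG : NG + 1 ≤ (toKT i).R * ((ℓ + 1) * (toKT i).Mh) := le_trans (Nat.succ_le_succ (le_max_right _ _)) hN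
  have hT0 : T₀ ≤ RM1 i := (le_max_left _ _).trans hT
  have hTG : TG ≤ RM1 i := (le_max_right _ _).trans hT
  -- UNIT 2 (d): the word laws at the cut potential; n06-a: the `G`-word IS `conj b(η²(padΔ(Ṽ))⁻¹)` and `padΔ(Ṽ)` is a unit
  obtain ⟨-, -, -, -, hrest⟩ := hG i c Rr H (parKnitCubeY i c) (parKnitCubeY_one i c) hMG hNG hTG
  obtain ⟨hw1, hw2, -, -⟩ := hrest α₁ hα0 (hα1.trans (min_le_right _ _)) (chartA i (cutFldS i (dirDomY i c) A))
    (kFCubeY i c (parKnitCubeY i c) (fun _ _ => 1) (cutCfgS i (dirDomY i c) (kGeo i).eta A))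
    (sFCubeY i c (parKnitCubeY i c) (fun _ _ => 1) (cutCfgS i (dirDomY i c) (kGeo i).eta A)) hkF hsF h337B h337F h337Bτ hA hAτB
  have hS1 : ∀ z : SiteY i, 1 ≤ B9CubeLettersOpsL0.levCubeY i c z → z ∈ dirDomY i c := fun z hz =>
    mem_dirDomC_of_lev_pos hL.1 (oddMh i) (toKT i).hMh (toKT i).hP c hz
  have hcompr := compr_sub_compr_eq_cutCfgS i c hS1 (kGeo i).eta A
  obtain ⟨hunit, hGext⟩ := GextDirK_eq_GpDirVK b i c (parKnitCubeY i c) A hcompr hw1 hw2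
  -- the `C`-engine on the carrier at the same data
  obtain ⟨Tinv, hT1, hT2, hTm⟩ := hC i c Rr H hM0 hN0 hT0 α₁ hα0 (hα1.trans (min_le_left _ _)) (chartA i (cutFldS i (dirDomY i c) A))
    (kFCubeY i c (parKnitCubeY i c) (fun _ _ => 1) (cutCfgS i (dirDomY i c) (kGeo i).eta A))
    (sFCubeY i c (parKnitCubeY i c) (fun _ _ => 1) (cutCfgS i (dirDomY i c) (kGeo i).eta A)) (cutCfgS i (dirDomY i c) (kGeo i).eta A)
    hkF hsF h337B hA hAτB hparV hF hFs
  -- rewrite the engine's `G`-word as the padded inverse at the small field, then the block word as def-Y's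
  have hGw := hGext
  unfold B9Cor36GpDirExtAtField.GextDirK B9Cor36GpDirExtAtField.VpDirK B9Cor36GpDirExtAtField.GpDirVK at hGw
  rw [hGw, word_at b i c _ hunit] at hT1 hT2
  obtain ⟨hUX, hTinv⟩ := eq_CinvR_of_laws b i c _ hT1 hT2
  exact ⟨hUX, hTinv ▸ hTm⟩

end Literature.MathematicalPhysics.QuantumFieldTheory.Balaban1983to89.B9Cor35CDirAtCubeField
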